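import Summits.ResolutionOfSingularities.ResolutionOfSingularities.Theorems.WeightedInvariantHypersurfaceLocalGameEFT
import Mathlib.RingTheory.KrullDimension.Basic
import HarnessLib

/-!
# Successor primes of a curve-centre move split by their trace on `S`: over the generic point (TYPE (a)) or over the special
# point (TYPE (b)) (door `HypersurfaceCentreConstruction`, stmt-ResolutionOfSingularities-19897; rung P3, regime CURVE° of
# IOTA3-DESIGN v1.3 §8.4; res-type-005, (o28) lead / (o36a) sequel)

Topic: `Summits/ResolutionOfSingularities/ResolutionOfSingularities/Theorems`. Helper for the door item
`HypersurfaceCentreConstruction` (stmt-ResolutionOfSingularities-19897, route `WeightedInvariant`), def-free.  At a curve-centre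
position `(S, f)` the centre prime `P` has `S ⧸ P` regular of dimension `1`; a successor prime `𝔫` of the cobordant algebra
`B = cobordantAlgebra' u w` with `P·B ≤ 𝔫` therefore traces on `S` in a prime between `P` and `𝔪`, i.e. `𝔫 ∩ S = P` (TYPE (a):
over the generic point of the centre — res-type-005's `iota_successor_lt_of_over_generic_point`, p532378) or `𝔫 ∩ S = 𝔪` (TYPE (b):
over the special point — res-type-092's (o36) special-fibre files).  This file proves the dichotomy and the glue that assembles
the two halves into the (drop) block of `CanonicalGameClauseLE`:

* `eq_or_eq_maximalIdeal_of_le_of_ringKrullDim_quotient_le_one` — `S` local, `P` prime with `dim (S ⧸ P) ≤ 1`, `Q ⊇ P` prime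
  ⇒ `Q = P ∨ Q = 𝔪` (Mathlib `Ring.KrullDimLE 1` on the domain `S ⧸ P`);
* `successor_comap_eq_or_eq_maximalIdeal` — the same for `Q = 𝔫 ∩ S`, `𝔫 ⊇ P·B` a prime of `cobordantAlgebra' u w`;
* `curve_drop_of_typeA_typeB` — the (drop) block at `(S, f)` for the move `(u, w)` with centre `P` from its TYPE (a) half
  (hypothesis `𝔫 ∩ S ≤ P`) and its TYPE (b) half (hypothesis `𝔪 ≤ 𝔫 ∩ S`).

[OURS · L1 W4.3 · (o36a) sequel]  Replaces the role of NO printed item; NOT a statement of the manuscript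
[claim: Hironaka2017, status: under-review]. AI work, weaker than expert review.

## References

* H. Matsumura, Commutative Ring Theory (1987), §5 (Krull dimension; primes in a one-dimensional local domain). [Matsumura1987]
* res-L1-w43-plan-1, IOTA3-DESIGN v1.3 §8.4 (CURVE°: type (a) + type (b)) (OURS, AI planning).
-/

noncomputable section

open IsLocalRing Literature.AlgebraicGeometry.Resolution
open Summit.ResolutionOfSingularities.ResolutionOfSingularities.Cruxes.HypersurfaceCentreConstruction.LocalEngine

set_option linter.dupNamespace false -- mandated namespace of this single-conjunct summit

namespace Summit.ResolutionOfSingularities.ResolutionOfSingularities.Theorems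

namespace ContactCylinder

/-- **Primes above a curve prime**: in a local ring `S`, if `P` is a prime with `ringKrullDim (S ⧸ P) ≤ 1` then every prime
`Q ⊇ P` is `P` or `𝔪` (in the one-dimensional local domain `S ⧸ P` a prime is `⊥` or maximal). [cite: Matsumura1987, §5] -/
theorem eq_or_eq_maximalIdeal_of_le_of_ringKrullDim_quotient_le_one {S : Type} [CommRing S] [IsLocalRing S] (P : Ideal S)
    [P.IsPrime] (hP1 : ringKrullDim (S ⧸ P) ≤ 1) (Q : Ideal S) [Q.IsPrime] (hPQ : P ≤ Q) :
    Q = P ∨ Q = maximalIdeal S := by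
  haveI : Ring.KrullDimLE 1 (S ⧸ P) := Ring.krullDimLE_iff.mpr hP1
  have hker : RingHom.ker (Ideal.Quotient.mk P) ≤ Q := by rw [Ideal.mk_ker]; exact hPQ
  haveI hQ' : (Q.map (Ideal.Quotient.mk P)).IsPrime := Ideal.map_isPrime_of_surjective Ideal.Quotient.mk_surjective hker
  have hback : (Q.map (Ideal.Quotient.mk P)).comap (Ideal.Quotient.mk P) = Q := by
    rw [Ideal.comap_map_of_surjective _ Ideal.Quotient.mk_surjective, ← RingHom.ker_eq_comap_bot, Ideal.mk_ker]
    exact sup_eq_left.mpr hPQ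
  by_cases hbot : Q.map (Ideal.Quotient.mk P) = ⊥
  · left
    refine le_antisymm (fun q hq => ?_) hPQ
    have h : Ideal.Quotient.mk P q ∈ Q.map (Ideal.Quotient.mk P) := Ideal.mem_map_of_mem _ hq
    rw [hbot, Ideal.mem_bot, Ideal.Quotient.eq_zero_iff_mem] at h
    exact h
  · right
    have hmax : (Q.map (Ideal.Quotient.mk P)).IsMaximal := Ideal.IsPrime.isMaximal_of_ne_bot hQ' hbot
    have hQmax : Q.IsMaximal := by
      rw [← hback]
      exact Ideal.comap_isMaximal_of_surjective _ Ideal.Quotient.mk_surjective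
    exact IsLocalRing.eq_maximalIdeal hQmax

/-- **Successor primes of a curve-centre move trace on `S` in `P` or in `𝔪`**: for a prime `𝔫` of `cobordantAlgebra' u w`
containing `P·B`, with `ringKrullDim (S ⧸ P) ≤ 1`: `𝔫 ∩ S = P` (TYPE (a)) or `𝔫 ∩ S = 𝔪` (TYPE (b)). [OURS · L1 W4.3 · (o36a)] -/
theorem successor_comap_eq_or_eq_maximalIdeal {S : Type} [CommRing S] [IsLocalRing S] {n : ℕ} (u : Fin n → S)
    (w : Fin n → ℕ) (P : Ideal S) [P.IsPrime] (hP1 : ringKrullDim (S ⧸ P) ≤ 1) (𝔫 : Ideal (cobordantAlgebra' u w))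
    [𝔫.IsPrime] (hP𝔫 : P.map (algebraMap S (cobordantAlgebra' u w)) ≤ 𝔫) :
    𝔫.comap (algebraMap S (cobordantAlgebra' u w)) = P ∨
      𝔫.comap (algebraMap S (cobordantAlgebra' u w)) = maximalIdeal S :=
  eq_or_eq_maximalIdeal_of_le_of_ringKrullDim_quotient_le_one P hP1 _ (Ideal.map_le_iff_le_comap.mp hP𝔫)

/-- **The (drop) block of a curve-centre move from its two halves.**  At a position `(S, f)` (`S` local) with a move `(u, w)`,
centre prime `P` with `ringKrullDim (S ⧸ P) ≤ 1`, and any target value `ι₀` (= `ι S f`): if the drop `ι (B_𝔫) (g/1) < ι₀` holds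
for every successor prime tracing in `P` (TYPE (a), `𝔫 ∩ S ≤ P`) and for every successor prime tracing in `𝔪` (TYPE (b),
`𝔪 ≤ 𝔫 ∩ S`), then it holds for every successor prime — in the literal binder shape of `CanonicalGameClauseLE` (`t⁻¹ ∈ 𝔫`,
`P·B ≤ 𝔫`, `𝔫 ⊉ vertex`, `f = (t⁻¹)^a g`, `t⁻¹ ∤ g`, `g/1 ∈ 𝔪_{B_𝔫}²`). [OURS · L1 W4.3 · (o36a)] -/
theorem curve_drop_of_typeA_typeB {ι : (R : Type) → [CommRing R] → R → Ordinal.{0}} {S : Type} [CommRing S] [IsLocalRing S]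
    {n : ℕ} (u : Fin n → S) (w : Fin n → ℕ) (P : Ideal S) [P.IsPrime] (hP1 : ringKrullDim (S ⧸ P) ≤ 1) (f : S)
    (ι₀ : Ordinal.{0})
    (hA : ∀ (𝔫 : Ideal (cobordantAlgebra' u w)) [𝔫.IsPrime], cobordantT' u w ∈ 𝔫 →
      P.map (algebraMap S (cobordantAlgebra' u w)) ≤ 𝔫 →
      ¬ extReesAlgebra.vertexIdeal (weightedMonomialIdeal u w) ≤ 𝔫 →
      𝔫.comap (algebraMap S (cobordantAlgebra' u w)) ≤ P →
      ∀ (a : ℕ) (g : cobordantAlgebra' u w), algebraMap S (cobordantAlgebra' u w) f = cobordantT' u w ^ a * g →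
        ¬ cobordantT' u w ∣ g →
        algebraMap (cobordantAlgebra' u w) (Localization.AtPrime 𝔫) g ∈ maximalIdeal (Localization.AtPrime 𝔫) ^ 2 →
        ι (Localization.AtPrime 𝔫) (algebraMap (cobordantAlgebra' u w) (Localization.AtPrime 𝔫) g) < ι₀)
    (hB : ∀ (𝔫 : Ideal (cobordantAlgebra' u w)) [𝔫.IsPrime], cobordantT' u w ∈ 𝔫 →
      P.map (algebraMap S (cobordantAlgebra' u w)) ≤ 𝔫 →
      ¬ extReesAlgebra.vertexIdeal (weightedMonomialIdeal u w) ≤ 𝔫 →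
      maximalIdeal S ≤ 𝔫.comap (algebraMap S (cobordantAlgebra' u w)) →
      ∀ (a : ℕ) (g : cobordantAlgebra' u w), algebraMap S (cobordantAlgebra' u w) f = cobordantT' u w ^ a * g →
        ¬ cobordantT' u w ∣ g →
        algebraMap (cobordantAlgebra' u w) (Localization.AtPrime 𝔫) g ∈ maximalIdeal (Localization.AtPrime 𝔫) ^ 2 →
        ι (Localization.AtPrime 𝔫) (algebraMap (cobordantAlgebra' u w) (Localization.AtPrime 𝔫) g) < ι₀) :
    ∀ (𝔫 : Ideal (cobordantAlgebra' u w)) [𝔫.IsPrime], cobordantT' u w ∈ 𝔫 →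
      P.map (algebraMap S (cobordantAlgebra' u w)) ≤ 𝔫 →
      ¬ extReesAlgebra.vertexIdeal (weightedMonomialIdeal u w) ≤ 𝔫 →
      ∀ (a : ℕ) (g : cobordantAlgebra' u w), algebraMap S (cobordantAlgebra' u w) f = cobordantT' u w ^ a * g →
        ¬ cobordantT' u w ∣ g →
        algebraMap (cobordantAlgebra' u w) (Localization.AtPrime 𝔫) g ∈ maximalIdeal (Localization.AtPrime 𝔫) ^ 2 →
        ι (Localization.AtPrime 𝔫) (algebraMap (cobordantAlgebra' u w) (Localization.AtPrime 𝔫) g) < ι₀ := by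
  intro 𝔫 _ hT hP𝔫 hV a g hfg hTg hg2
  rcases successor_comap_eq_or_eq_maximalIdeal u w P hP1 𝔫 hP𝔫 with h | h
  · exact hA 𝔫 hT hP𝔫 hV h.le a g hfg hTg hg2
  · exact hB 𝔫 hT hP𝔫 hV h.ge a g hfg hTg hg2

end ContactCylinder

end Summit.ResolutionOfSingularities.ResolutionOfSingularities.Theorems

end
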